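import Literature.Analysis.Complex.SectorPolydiscCharts
import Mathlib.Analysis.SpecialFunctions.Complex.LogDeriv
import Mathlib.Analysis.SpecialFunctions.Complex.LogBounds
import HarnessLib

/-!
# From the logarithmic `ℓ¹`-tube to sector polydiscs: explicit bounds and parameters

Analysis/Complex support file. A function `F` holomorphic on the tube `{∑ⱼ |Im zⱼ| < π/2}` in the
logarithmic variables `zⱼ = log wⱼ` (the output of the flat tube theorem,
`Literature.Analysis.Complex.l1TubeExtension_spec`, as applied in Osterwalder–Schrader II, Ch. V.1,
(5.8): "a function … analytic in `{w | ∑ |arg wᵢ| < π/2}`") gives the **sector extension**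

  `logSectorExt b F w = e^{2b∑ⱼ (log wⱼ)²} F(log w₁, …, log w_{K+1})`,

holomorphic on the sector region `{Re wⱼ > 0, ∑ |arg wⱼ| < π/2}` (`differentiableOn_logSectorExt`);
when `F(x) = e^{-2b∑xⱼ²} S(eˣ)` at real points, `logSectorExt b F u = S u` for `u > 0`
(`logSectorExt_ofReal`). The point of the file is the quantitative control on **polydiscs about a
positive real point** `u` (sup-norm balls `‖w − u‖_∞ < ρ`), as needed by the analytic
deconvolution lemma (`AnalyticDeconvolution`):

* `ball_subset_sectorRegion` — if `ρ ≤ uⱼ sin(π/(4(K+1)))` for all `j`, the polydisc lies in the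
  sector region with `∑ |arg wⱼ| < π/4` (one `SectorPolydiscCharts.re_pos_and_abs_arg_lt_of_norm_sub_lt`
  per coordinate);
* `norm_logSectorExt_le` — **explicit bound on the polydisc**: if `‖F z‖ ≤ Kc` on
  `{∑ |Im zⱼ| ≤ π/4}`, then `‖logSectorExt b F w‖ ≤ exp(2b(K+1)(Λ + π/4)²) Kc` with
  `Λ = logRadius u ρ` an explicit bound of `|log |wⱼ||` on the polydisc;
* `continuousOn_logSectorExt_param` — **joint continuity in a parameter**: if `(ω, z) ↦ F ω z` is
  jointly continuous on `Ω × tube` then `(ω, w) ↦ logSectorExt b (F ω) w` is jointly continuous on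
  `Ω × sector region`.

## References

* K. Osterwalder, R. Schrader, *Axioms for Euclidean Green's functions II*, Comm. Math. Phys. 42
  (1975) 281–305, Ch. V.1 eq. (5.8), Lemma 5.1. [OsterwalderSchraderCMP1975]

Everything here is elementary and tagged folklore.
-/

noncomputable section

open Set Metric Filter Real
open scoped Topology

namespace Literature.Analysis.Complex

variable {K : ℕ}

/-! ### The sector region and the extension -/

/-- The **sector region** `{w | ∀ j, Re wⱼ > 0, ∑ⱼ |arg wⱼ| < c}`. [folklore] -/
def sectorRegion (K : ℕ) (c : ℝ) : Set (Fin (K + 1) → ℂ) :=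
  {w | (∀ j, 0 < (w j).re) ∧ ∑ j, |Complex.arg (w j)| < c}

/-- The coordinatewise logarithm. [folklore] -/
def logPi (w : Fin (K + 1) → ℂ) : Fin (K + 1) → ℂ := fun j => Complex.log (w j)

/-- **The sector extension** `e^{2b∑(log wⱼ)²} F(log w)`. [cite: OsterwalderSchraderCMP1975, Ch. V.1 eq. (5.8)] -/
def logSectorExt (b : ℝ) (F : (Fin (K + 1) → ℂ) → ℂ) (w : Fin (K + 1) → ℂ) : ℂ :=
  Complex.exp ((2 * b : ℂ) * ∑ j, (Complex.log (w j)) ^ 2) * F (logPi w)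

/-- The coordinatewise logarithm maps the sector region of level `c` into the `ℓ¹`-tube of level
`c` (`Im log w = arg w`). [folklore] -/
theorem logPi_mem_tube {c : ℝ} {w : Fin (K + 1) → ℂ} (hw : w ∈ sectorRegion K c) :
    ∑ j, |(logPi w j).im| < c := by
  simp only [logPi, Complex.log_im]
  exact hw.2

/-- The coordinatewise logarithm is holomorphic on the sector region. [folklore] -/
theorem differentiableOn_logPi (c : ℝ) : DifferentiableOn ℂ (logPi (K := K)) (sectorRegion K c) :=
  differentiableOn_pi.2 fun j w hw =>
    ((differentiableAt_apply (𝕜 := ℂ) j w).clog (Or.inl (hw.1 j))).differentiableWithinAt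

/-- The coordinatewise logarithm is continuous on the sector region. [folklore] -/
theorem continuousOn_logPi (c : ℝ) : ContinuousOn (logPi (K := K)) (sectorRegion K c) :=
  (differentiableOn_logPi c).continuousOn

/-- **Holomorphy of the sector extension**: if `F` is holomorphic on `{∑ |Im zⱼ| < c}` then
`logSectorExt b F` is holomorphic on the sector region of level `c`. [folklore] -/
theorem differentiableOn_logSectorExt (b : ℝ) {F : (Fin (K + 1) → ℂ) → ℂ} {c : ℝ}
    (hF : DifferentiableOn ℂ F {z : Fin (K + 1) → ℂ | ∑ j, |(z j).im| < c}) :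
    DifferentiableOn ℂ (logSectorExt b F) (sectorRegion K c) := by
  have hlogj : ∀ j, DifferentiableOn ℂ (fun w : Fin (K + 1) → ℂ => Complex.log (w j)) (sectorRegion K c) :=
    fun j w hw => ((differentiableAt_apply (𝕜 := ℂ) j w).clog (Or.inl (hw.1 j))).differentiableWithinAt
  refine DifferentiableOn.mul ?_ (hF.comp (differentiableOn_logPi c) fun w hw => logPi_mem_tube hw)
  exact ((differentiableOn_const _).mul (DifferentiableOn.fun_sum fun j _ => (hlogj j).pow 2)).cexp

/-- **Real points**: if `F(x) = e^{-2b∑xⱼ²} S(eˣ)` for real `x`, then `logSectorExt b F u = S u` for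
`u > 0` (coordinatewise). [folklore] -/
theorem logSectorExt_ofReal (b : ℝ) {F : (Fin (K + 1) → ℂ) → ℂ} {S : (Fin (K + 1) → ℝ) → ℂ}
    (hFx : ∀ x : Fin (K + 1) → ℝ, F (fun j => (x j : ℂ)) =
      Complex.exp (-(2 * b : ℂ) * ∑ j, (x j : ℂ) ^ 2) * S (fun j => Real.exp (x j)))
    {u : Fin (K + 1) → ℝ} (hu : ∀ j, 0 < u j) :
    logSectorExt b F (fun j => (u j : ℂ)) = S u := by
  have hL : logPi (fun j => (u j : ℂ)) = fun j => ((Real.log (u j) : ℝ) : ℂ) := by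
    funext j; simp only [logPi]; rw [Complex.ofReal_log (hu j).le]
  rw [logSectorExt, hL, hFx]
  have hexp : (fun j => Real.exp (Real.log (u j))) = u := funext fun j => Real.exp_log (hu j)
  rw [hexp, ← mul_assoc, ← Complex.exp_add]
  have h0 : (2 * b : ℂ) * ∑ j, Complex.log (u j : ℂ) ^ 2 + -(2 * b : ℂ) * ∑ j, ((Real.log (u j) : ℝ) : ℂ) ^ 2 = 0 := by
    have : ∀ j, Complex.log (u j : ℂ) = ((Real.log (u j) : ℝ) : ℂ) := fun j => (Complex.ofReal_log (hu j).le).symm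
    simp_rw [this]; ring
  rw [h0, Complex.exp_zero, one_mul]

/-! ### Polydiscs about positive real points -/

/-- **A polydisc about a positive real point lies in the sector region of level `π/4`** when its
radius is at most `uⱼ sin(π/(4(K+1)))` for every `j`. [folklore] -/
theorem ball_subset_sectorRegion {u : Fin (K + 1) → ℝ} {ρ : ℝ}
    (hρ : ∀ j, ρ ≤ u j * Real.sin (π / (4 * (K + 1)))) :
    ball (fun j => (u j : ℂ)) ρ ⊆ sectorRegion K (π / 4) := by
  intro w hw
  have hα0 : 0 < π / (4 * (K + 1)) := by positivity
  have hα : π / (4 * (K + 1)) < π / 2 := by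
    rw [div_lt_div_iff_of_pos_left Real.pi_pos (by positivity) (by positivity)]
    have : (1 : ℝ) ≤ K + 1 := by simp
    nlinarith
  have hj : ∀ j, 0 < (w j).re ∧ |Complex.arg (w j)| < π / (4 * (K + 1)) := fun j => by
    refine re_pos_and_abs_arg_lt_of_norm_sub_lt hα0 hα (lt_of_lt_of_le ?_ (hρ j))
    have h := (mem_ball.1 hw)
    rw [dist_eq_norm] at h
    exact lt_of_le_of_lt (norm_le_pi_norm (w - fun j => (u j : ℂ)) j) h
  refine ⟨fun j => (hj j).1, ?_⟩
  calc ∑ j, |Complex.arg (w j)| < ∑ _j : Fin (K + 1), π / (4 * (K + 1)) :=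
        Finset.sum_lt_sum_of_nonempty Finset.univ_nonempty fun j _ => (hj j).2
    _ = π / 4 := by
        rw [Finset.sum_const, Finset.card_univ, Fintype.card_fin, nsmul_eq_mul]
        push_cast
        field_simp

/-- **An explicit bound of `|log |wⱼ||` on the polydisc**: `Λ = max(|log(u_min − ρ)|, |log(u_max + ρ)|)`-type
constant, here `|log (m - ρ)| + |log (M + ρ)|` with `m, M` the extreme coordinates. [folklore] -/
def logRadius (u : Fin (K + 1) → ℝ) (ρ : ℝ) : ℝ :=
  |Real.log ((Finset.univ.inf' Finset.univ_nonempty u) - ρ)| +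
    |Real.log ((Finset.univ.sup' Finset.univ_nonempty u) + ρ)|

/-- On the polydisc, `|log ‖wⱼ‖| ≤ logRadius u ρ` (`0 < u_min − ρ`). [folklore] -/
theorem abs_log_norm_le_logRadius {u : Fin (K + 1) → ℝ} {ρ : ℝ}
    (hρ : ρ < Finset.univ.inf' Finset.univ_nonempty u) {w : Fin (K + 1) → ℂ}
    (hw : w ∈ ball (fun j => (u j : ℂ)) ρ) (j : Fin (K + 1)) :
    |Real.log ‖w j‖| ≤ logRadius u ρ := by
  set m : ℝ := Finset.univ.inf' Finset.univ_nonempty u with hm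
  set M : ℝ := Finset.univ.sup' Finset.univ_nonempty u with hM
  have hρ0 : 0 ≤ ρ := by
    have h := (mem_ball.1 hw).le
    exact le_trans dist_nonneg h
  have hmj : m ≤ u j := Finset.inf'_le _ (Finset.mem_univ j)
  have hMj : u j ≤ M := Finset.le_sup' _ (Finset.mem_univ j)
  have hwj : ‖w j - (u j : ℂ)‖ < ρ := by
    have h := mem_ball.1 hw
    rw [dist_eq_norm] at h
    exact lt_of_le_of_lt (norm_le_pi_norm (w - fun j => (u j : ℂ)) j) h
  have hlow : m - ρ < ‖w j‖ := by
    have h1 : ‖(u j : ℂ)‖ - ‖w j - (u j : ℂ)‖ ≤ ‖w j‖ := by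
      have := norm_sub_norm_le (u j : ℂ) ((u j : ℂ) - w j)
      rw [sub_sub_cancel, norm_sub_rev] at this
      linarith
    rw [Complex.norm_real, Real.norm_eq_abs, abs_of_pos (lt_of_lt_of_le (lt_of_le_of_lt hρ0 hρ) hmj)] at h1
    linarith
  have hhigh : ‖w j‖ < M + ρ := by
    have h1 : ‖w j‖ ≤ ‖(u j : ℂ)‖ + ‖w j - (u j : ℂ)‖ := by
      have := norm_add_le (u j : ℂ) (w j - (u j : ℂ))
      rwa [add_sub_cancel] at this
    rw [Complex.norm_real, Real.norm_eq_abs, abs_of_pos (lt_of_lt_of_le (lt_of_le_of_lt hρ0 hρ) hmj)] at h1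
    linarith
  have hpos : 0 < m - ρ := by linarith
  have hwpos : 0 < ‖w j‖ := lt_trans hpos hlow
  rw [logRadius, ← hm, ← hM]
  have hlog_low : Real.log (m - ρ) ≤ Real.log ‖w j‖ := Real.log_le_log hpos hlow.le
  have hlog_high : Real.log ‖w j‖ ≤ Real.log (M + ρ) := Real.log_le_log hwpos hhigh.le
  rcases le_or_gt 0 (Real.log ‖w j‖) with h | h
  · rw [abs_of_nonneg h]
    exact le_trans (le_trans hlog_high (le_abs_self _)) (le_add_of_nonneg_left (abs_nonneg _))
  · rw [abs_of_neg h]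
    have : -Real.log ‖w j‖ ≤ |Real.log (m - ρ)| := by
      have := neg_le_abs (Real.log (m - ρ)); linarith
    exact le_trans this (le_add_of_nonneg_right (abs_nonneg _))

/-- **Explicit bound of the sector extension on the polydisc**: with `‖F z‖ ≤ Kc` on
`{∑ |Im zⱼ| ≤ π/4}`, `‖logSectorExt b F w‖ ≤ exp(2|b|(K+1)(Λ + π/4)²) Kc`. [folklore] -/
theorem norm_logSectorExt_le (b : ℝ) {F : (Fin (K + 1) → ℂ) → ℂ} {Kc : ℝ}
    (hK : ∀ z : Fin (K + 1) → ℂ, ∑ j, |(z j).im| ≤ π / 4 → ‖F z‖ ≤ Kc)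
    {u : Fin (K + 1) → ℝ} {ρ : ℝ} (hρ : ∀ j, ρ ≤ u j * Real.sin (π / (4 * (K + 1))))
    (hρm : ρ < Finset.univ.inf' Finset.univ_nonempty u)
    {w : Fin (K + 1) → ℂ} (hw : w ∈ ball (fun j => (u j : ℂ)) ρ) :
    ‖logSectorExt b F w‖ ≤ Real.exp (2 * |b| * (K + 1) * (logRadius u ρ + π / 4) ^ 2) * Kc := by
  have hsec := ball_subset_sectorRegion hρ hw
  rw [logSectorExt, norm_mul]
  refine mul_le_mul ?_ (hK _ (logPi_mem_tube hsec).le) (norm_nonneg _) (Real.exp_pos _).le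
  rw [Complex.norm_exp]
  refine Real.exp_le_exp.2 ?_
  -- `Re (2b ∑ (log wⱼ)²) ≤ 2|b| ∑ |log wⱼ|² ≤ 2|b| (K+1) (Λ + π/4)²`
  have hre : ((2 * b : ℂ) * ∑ j, Complex.log (w j) ^ 2).re ≤ 2 * |b| * ∑ j, ‖Complex.log (w j)‖ ^ 2 := by
    refine (Complex.re_le_norm _).trans ?_
    rw [norm_mul]
    have h2b : ‖(2 * b : ℂ)‖ = 2 * |b| := by
      rw [show (2 * b : ℂ) = ((2 * b : ℝ) : ℂ) by push_cast; ring, Complex.norm_real, Real.norm_eq_abs, abs_mul,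
        abs_of_pos two_pos]
    rw [h2b]
    refine mul_le_mul_of_nonneg_left ((norm_sum_le _ _).trans (Finset.sum_le_sum fun j _ => ?_)) (by positivity)
    rw [norm_pow]
  refine hre.trans ?_
  have hterm : ∀ j, ‖Complex.log (w j)‖ ^ 2 ≤ (logRadius u ρ + π / 4) ^ 2 := fun j => by
    have h1 : ‖Complex.log (w j)‖ ≤ |(Complex.log (w j)).re| + |(Complex.log (w j)).im| :=
      Complex.norm_le_abs_re_add_abs_im _
    rw [Complex.log_re, Complex.log_im] at h1
    have h2 : |Real.log ‖w j‖| ≤ logRadius u ρ := abs_log_norm_le_logRadius hρm hw j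
    have h3 : |Complex.arg (w j)| ≤ π / 4 := by
      have hs := hsec.2
      have := Finset.single_le_sum (f := fun j => |Complex.arg (w j)|) (fun j _ => abs_nonneg _) (Finset.mem_univ j)
      linarith
    have h4 : 0 ≤ logRadius u ρ + π / 4 := by
      have := abs_nonneg (Real.log ‖w j‖); linarith [h2, Real.pi_pos.le]
    exact pow_le_pow_left₀ (norm_nonneg _) (by linarith) 2
  calc 2 * |b| * ∑ j, ‖Complex.log (w j)‖ ^ 2 ≤ 2 * |b| * ∑ _j : Fin (K + 1), (logRadius u ρ + π / 4) ^ 2 :=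
        mul_le_mul_of_nonneg_left (Finset.sum_le_sum fun j _ => hterm j) (by positivity)
    _ = 2 * |b| * (K + 1) * (logRadius u ρ + π / 4) ^ 2 := by
        rw [Finset.sum_const, Finset.card_univ, Fintype.card_fin, nsmul_eq_mul]
        push_cast
        ring

/-! ### Joint continuity in a parameter -/

/-- **Joint continuity of the sector extensions of a jointly continuous family**: if
`(ω, z) ↦ F ω z` is continuous on `Ω × {∑ |Im zⱼ| < c}` then `(ω, w) ↦ logSectorExt b (F ω) w` is
continuous on `Ω × sectorRegion K c`. [folklore] -/
theorem continuousOn_logSectorExt_param {Ω : Type*} [TopologicalSpace Ω] (b : ℝ)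
    {F : Ω → (Fin (K + 1) → ℂ) → ℂ} {c : ℝ} {T : Set Ω}
    (hF : ContinuousOn (fun q : Ω × (Fin (K + 1) → ℂ) => F q.1 q.2) (T ×ˢ {z : Fin (K + 1) → ℂ | ∑ j, |(z j).im| < c})) :
    ContinuousOn (fun q : Ω × (Fin (K + 1) → ℂ) => logSectorExt b (F q.1) q.2) (T ×ˢ sectorRegion K c) := by
  have hlog : ContinuousOn (fun q : Ω × (Fin (K + 1) → ℂ) => logPi q.2) (T ×ˢ sectorRegion K c) :=
    (continuousOn_logPi c).comp continuous_snd.continuousOn fun q hq => (mem_prod.1 hq).2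
  have hexp : ContinuousOn (fun q : Ω × (Fin (K + 1) → ℂ) =>
      Complex.exp ((2 * b : ℂ) * ∑ j, (Complex.log (q.2 j)) ^ 2)) (T ×ˢ sectorRegion K c) := by
    have hg : Continuous fun z : Fin (K + 1) → ℂ => (2 * b : ℂ) * ∑ j, (z j) ^ 2 :=
      continuous_const.mul (continuous_finsetSum _ fun j _ => (continuous_apply j).pow 2)
    have h := (hg.continuousOn.comp hlog (mapsTo_univ _ _)).cexp
    refine h.congr fun q _ => ?_
    simp only [Function.comp_apply, logPi]
  have hFc : ContinuousOn (fun q : Ω × (Fin (K + 1) → ℂ) => F q.1 (logPi q.2)) (T ×ˢ sectorRegion K c) := by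
    have hmap : MapsTo (fun q : Ω × (Fin (K + 1) → ℂ) => (q.1, logPi q.2)) (T ×ˢ sectorRegion K c)
        (T ×ˢ {z : Fin (K + 1) → ℂ | ∑ j, |(z j).im| < c}) :=
      fun q hq => mk_mem_prod (mem_prod.1 hq).1 (logPi_mem_tube (mem_prod.1 hq).2)
    have h := hF.comp (continuousOn_fst.prodMk hlog) hmap
    exact h.congr fun q _ => by simp only [Function.comp_apply]
  exact (hexp.mul hFc).congr fun q _ => by simp only [logSectorExt, Pi.mul_apply]

end Literature.Analysis.Complex
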